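import Literature.Computability.Complexity.ProductSpaceDecomposition
import Mathlib.Analysis.Convex.SpecificFunctions.Basic
import Mathlib.Data.Real.Sign
import HarnessLib

/-!
# Randomization/symmetrization: the noise operators `T_r` are `L^{4/3}`- and `L⁴`-contractions

O'Donnell, *Analysis of Boolean Functions* (CUP 2014), §10.4, in the uniform finite product-space
setting of `ProductSpaceDecomposition.lean`: for `r : ι → ℝ` the operator
`T_r f = ∑_S r^S f^{=S}` (Def. 10.40, eq. (10.15)); `T_r = ∏_i T^i_{r_i}` with the one-coordinate
operators `T^i_ρ f = E_i f + ρ L_i f` (10.14); and **Theorem 10.44** ("un-randomization/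
symmetrization"): `‖T_{c_q r} f‖_q ≤ ‖f‖_q` for every sign vector `r ∈ {±1}^ι`, with
`c_4 = c_{4/3} = 2/5`, proved as printed: each `T^i_ρ` with `ρ ∈ [0,1]` is an `L^q` contraction
(convexity), and `T^i_{-2/5}` is one by **Lemma 10.43** (`‖a - (2/5) X‖₄ ≤ ‖a + X‖₄` for mean-zero
`X`; here via the sum-of-squares identity
`609·625·((a+x)⁴ - (a - 2x/5)⁴ - (28/5) a³ x) = (x(609x + 1330a))² + 149450 (ax)²`) and, for
`q = 4/3`, by duality (O'Donnell Prop. 9.19: the one-variable operator is self-adjoint).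

## Results (all proved)

* `stepOne`, `avg_rpow_stepOne_le_of_nonneg`, `avg_pow_four_stepOne_neg_le`,
  `avg_rpow_stepOne_neg_le` — the one-variable contractions;
* `stepT`, `stepT_sum_pure` (`T^i_ρ` acts diagonally on the decomposition), `noiseT`, `noiseTA`,
  `noiseTA_insert` (`T_r = ∏ T^i_{r_i}`), `avg_eq_avg_avg_update` (fibering over a coordinate);
* `avg_pow_four_noiseT_le`, `avg_rpow_noiseT_le` — **Theorem 10.44** for `q = 4` and `q = 4/3`:
  if every `r_i ∈ [0,1] ∪ {-2/5}` then `E (T_r f)⁴ ≤ E f⁴` and `E |T_r f|^{4/3} ≤ E |f|^{4/3}`.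

## References

* R. O'Donnell, *Analysis of Boolean Functions*, CUP 2014, §10.4: Def. 10.40, Fact 10.41,
  Lemma 10.43, Theorem 10.44; Prop. 9.19 (duality) [ODonnell2014].
* J. Bourgain, *Walsh subspaces of `L^p`-product spaces*, Sém. Anal. Fonct. 1979–80 (original).
-/

noncomputable section

namespace Literature.Computability.Complexity

namespace ProductSpace

open Finset Real

/-! ### Hölder and Jensen for uniform averages -/

section AvgIneq

variable {α : Type*} [Fintype α]

/-- **Hölder for uniform averages**: `E[g h] ≤ (E|g|^p)^{1/p} (E|h|^q)^{1/q}` for conjugate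
`p, q`. [folklore] -/
theorem avg_mul_le_holder {p q : ℝ} (hpq : p.HolderConjugate q) (g h : α → ℝ) :
    avg (fun a => g a * h a) ≤
      (avg fun a => |g a| ^ p) ^ (1 / p) * (avg fun a => |h a| ^ q) ^ (1 / q) := by
  have hH := Real.inner_le_Lp_mul_Lq (Finset.univ : Finset α) g h hpq
  set N : ℝ := (Fintype.card α : ℝ) with hN
  have hN0 : 0 ≤ N := Nat.cast_nonneg _
  have hsum : 1 / p + 1 / q = 1 := by
    have := hpq.inv_add_inv_eq_one; simpa [one_div] using this
  have hS1 : 0 ≤ ∑ a, |g a| ^ p := Finset.sum_nonneg fun a _ => Real.rpow_nonneg (abs_nonneg _) _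
  have hS2 : 0 ≤ ∑ a, |h a| ^ q := Finset.sum_nonneg fun a _ => Real.rpow_nonneg (abs_nonneg _) _
  have key : (avg fun a => |g a| ^ p) ^ (1 / p) * (avg fun a => |h a| ^ q) ^ (1 / q) =
      ((∑ a, |g a| ^ p) ^ (1 / p) * (∑ a, |h a| ^ q) ^ (1 / q)) / N := by
    unfold avg
    rw [Real.div_rpow hS1 hN0, Real.div_rpow hS2 hN0, div_mul_div_comm]
    congr 1
    rw [← Real.rpow_add' hN0 (by rw [hsum]; norm_num), hsum, Real.rpow_one]
  rw [key]
  exact div_le_div_of_nonneg_right hH hN0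

/-- **Power-mean / Jensen**: `(E |g|)^q ≤ E |g|^q` for `q ≥ 1`. [folklore] -/
theorem rpow_avg_abs_le [Nonempty α] (g : α → ℝ) {q : ℝ} (hq : 1 ≤ q) :
    (avg fun a => |g a|) ^ q ≤ avg fun a => |g a| ^ q := by
  have hN : (0 : ℝ) < Fintype.card α := by exact_mod_cast Fintype.card_pos
  have h := Real.rpow_arith_mean_le_arith_mean_rpow (Finset.univ : Finset α)
    (fun _ => 1 / (Fintype.card α : ℝ)) (fun a => |g a|) (fun _ _ => by positivity)
    (by rw [Finset.sum_const, Finset.card_univ, nsmul_eq_mul]; field_simp)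
    (fun _ _ => abs_nonneg _) hq
  have e1 : ∑ a, 1 / (Fintype.card α : ℝ) * |g a| = avg fun a => |g a| := by
    rw [avg, ← Finset.mul_sum]; ring
  have e2 : ∑ a, 1 / (Fintype.card α : ℝ) * |g a| ^ q = avg fun a => |g a| ^ q := by
    rw [avg, ← Finset.mul_sum]; ring
  rwa [e1, e2] at h

/-- `|E g|^q ≤ E |g|^q` for `q ≥ 1`. [folklore] -/
theorem abs_avg_rpow_le [Nonempty α] (g : α → ℝ) {q : ℝ} (hq : 1 ≤ q) :
    |avg g| ^ q ≤ avg fun a => |g a| ^ q :=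
  (Real.rpow_le_rpow (abs_nonneg _) (abs_avg_le g) (by linarith)).trans (rpow_avg_abs_le g hq)

/-- `(E |g|^{4/3})^{3/2} ≤ E g²` (power means `4/3 ≤ 2`). [folklore] -/
theorem avg_rpow_four_thirds_le [Nonempty α] (g : α → ℝ) :
    (avg fun a => |g a| ^ (4 / 3 : ℝ)) ^ (3 / 2 : ℝ) ≤ avg fun a => g a ^ 2 := by
  have h := rpow_avg_abs_le (fun a => |g a| ^ (4 / 3 : ℝ)) (q := 3 / 2) (by norm_num)
  have e1 : ∀ a, |(|g a| ^ (4 / 3 : ℝ))| = |g a| ^ (4 / 3 : ℝ) := fun a =>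
    abs_of_nonneg (Real.rpow_nonneg (abs_nonneg _) _)
  have e2 : ∀ a, (|g a| ^ (4 / 3 : ℝ)) ^ (3 / 2 : ℝ) = g a ^ 2 := by
    intro a
    rw [← Real.rpow_mul (abs_nonneg _)]
    norm_num
  simp only [e1, e2] at h
  exact h

end AvgIneq

/-! ### One variable: the operators `T_ρ h = E h + ρ (h - E h)` -/

section OneVar

variable {Ω : Type*} [Fintype Ω] [Nonempty Ω]

/-- The one-variable noise operator `T_ρ h = E h + ρ (h - E h)` (O'Donnell 2014, (10.14) with
`n = 1`). [cite: ODonnell2014, Def. 10.40] -/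
def stepOne (ρ : ℝ) (h : Ω → ℝ) (ω : Ω) : ℝ := avg h + ρ * (h ω - avg h)

/-- `T_ρ` preserves the mean. [cite: ODonnell2014, Def. 10.40] -/
theorem avg_stepOne (ρ : ℝ) (h : Ω → ℝ) : avg (stepOne ρ h) = avg h := by
  unfold stepOne
  rw [avg_add, avg_const, avg_mul_left, avg_sub, avg_const, sub_self, mul_zero, add_zero]

/-- **`T_ρ` is an `L^q` contraction for `0 ≤ ρ ≤ 1`, `q ≥ 1`** (O'Donnell 2014, Exercise 8.11 /
proof of Thm. 10.44: convexity and Jensen). [cite: ODonnell2014, Theorem 10.44] -/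
theorem avg_rpow_stepOne_le_of_nonneg {ρ : ℝ} (hρ0 : 0 ≤ ρ) (hρ1 : ρ ≤ 1) (h : Ω → ℝ) {q : ℝ}
    (hq : 1 ≤ q) : avg (fun ω => |stepOne ρ h ω| ^ q) ≤ avg fun ω => |h ω| ^ q := by
  have hq0 : 0 ≤ q := by linarith
  -- pointwise convexity: `|(1-ρ) μ + ρ h|^q ≤ (1-ρ) |μ|^q + ρ |h|^q`
  have hpt : ∀ ω, |stepOne ρ h ω| ^ q ≤ (1 - ρ) * |avg h| ^ q + ρ * |h ω| ^ q := by
    intro ω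
    have e : stepOne ρ h ω = (1 - ρ) * avg h + ρ * h ω := by unfold stepOne; ring
    rw [e]
    have htri : |(1 - ρ) * avg h + ρ * h ω| ≤ (1 - ρ) * |avg h| + ρ * |h ω| := by
      calc |(1 - ρ) * avg h + ρ * h ω| ≤ |(1 - ρ) * avg h| + |ρ * h ω| := abs_add_le _ _
        _ = (1 - ρ) * |avg h| + ρ * |h ω| := by
            rw [abs_mul, abs_mul, abs_of_nonneg (by linarith : 0 ≤ 1 - ρ), abs_of_nonneg hρ0]
    have hconv := (convexOn_rpow hq).2 (Set.mem_Ici.2 (abs_nonneg (avg h)))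
      (Set.mem_Ici.2 (abs_nonneg (h ω))) (by linarith : 0 ≤ 1 - ρ) hρ0 (by ring)
    simp only [smul_eq_mul] at hconv
    exact (Real.rpow_le_rpow (abs_nonneg _) htri hq0).trans hconv
  calc avg (fun ω => |stepOne ρ h ω| ^ q)
      ≤ avg (fun ω => (1 - ρ) * |avg h| ^ q + ρ * |h ω| ^ q) := avg_mono hpt
    _ = (1 - ρ) * |avg h| ^ q + ρ * avg (fun ω => |h ω| ^ q) := by
        rw [avg_add, avg_const, avg_mul_left]
    _ ≤ (1 - ρ) * avg (fun ω => |h ω| ^ q) + ρ * avg (fun ω => |h ω| ^ q) := by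
        have := abs_avg_rpow_le h hq
        nlinarith
    _ = avg fun ω => |h ω| ^ q := by ring

/-- **Lemma 10.43, the polynomial inequality** (O'Donnell 2014, (10.19)–(10.20) with `c = 2/5`):
`(a + x)⁴ - (a - (2/5) x)⁴ - (28/5) a³ x ≥ 0` for all real `a, x` — indeed
`609·625` times it is `(x(609x+1330a))² + 149450 (ax)²`. [cite: ODonnell2014, Lemma 10.43] -/
theorem lemma1043_pointwise (a x : ℝ) :
    (28 / 5) * a ^ 3 * x ≤ (a + x) ^ 4 - (a - 2 / 5 * x) ^ 4 := by
  nlinarith [sq_nonneg (x * (609 * x + 1330 * a)), sq_nonneg (a * x)]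

/-- **Lemma 10.43** (O'Donnell 2014, `q = 4`, `c_4 = 2/5`): `E (E h - (2/5)(h - E h))⁴ ≤ E h⁴`,
i.e. `‖a - c X‖₄ ≤ ‖a + X‖₄` for the mean-zero `X = h - E h`. [cite: ODonnell2014, Lemma 10.43] -/
theorem avg_pow_four_stepOne_neg_le (h : Ω → ℝ) :
    avg (fun ω => stepOne (-2 / 5) h ω ^ 4) ≤ avg fun ω => h ω ^ 4 := by
  have hpt : ∀ ω, (28 / 5) * avg h ^ 3 * (h ω - avg h) ≤ h ω ^ 4 - stepOne (-2 / 5) h ω ^ 4 := by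
    intro ω
    have := lemma1043_pointwise (avg h) (h ω - avg h)
    have e1 : avg h + (h ω - avg h) = h ω := by ring
    have e2 : avg h - 2 / 5 * (h ω - avg h) = stepOne (-2 / 5) h ω := by unfold stepOne; ring
    rwa [e1, e2] at this
  have h0 : avg (fun ω => (28 / 5) * avg h ^ 3 * (h ω - avg h)) = 0 := by
    rw [avg_mul_left, avg_sub, avg_const, sub_self, mul_zero]
  have := avg_mono hpt
  rw [h0, avg_sub] at this
  linarith

omit [Nonempty Ω] in
/-- Self-adjointness of the one-variable operator: `E[(T_ρ h) g] = E[h (T_ρ g)]`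
(O'Donnell 2014, Exercise 8.7 / Prop. 9.19). [cite: ODonnell2014, Prop. 9.19] -/
theorem avg_stepOne_mul (ρ : ℝ) (h g : Ω → ℝ) :
    avg (fun ω => stepOne ρ h ω * g ω) = avg (fun ω => h ω * stepOne ρ g ω) := by
  unfold stepOne
  have e1 : ∀ ω, (avg h + ρ * (h ω - avg h)) * g ω =
      (1 - ρ) * avg h * g ω + ρ * (h ω * g ω) := fun ω => by ring
  have e2 : ∀ ω, h ω * (avg g + ρ * (g ω - avg g)) =
      (1 - ρ) * avg g * h ω + ρ * (h ω * g ω) := fun ω => by ring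
  simp_rw [e1, e2]
  rw [avg_add, avg_add, avg_mul_left, avg_mul_left, avg_mul_left]
  ring

/-- `u · (sign u |u|^{1/3}) = |u|^{4/3}`. [folklore] -/
theorem mul_sign_mul_rpow_third (u : ℝ) :
    u * (Real.sign u * |u| ^ (1 / 3 : ℝ)) = |u| ^ (4 / 3 : ℝ) := by
  have key : u * Real.sign u = |u| := by
    rcases lt_trichotomy u 0 with hu | hu | hu
    · rw [Real.sign_of_neg hu, abs_of_neg hu]; ring
    · rw [hu]; simp
    · rw [Real.sign_of_pos hu, abs_of_pos hu]; ring
  calc u * (Real.sign u * |u| ^ (1 / 3 : ℝ)) = (u * Real.sign u) * |u| ^ (1 / 3 : ℝ) := by ring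
    _ = |u| ^ (1 : ℝ) * |u| ^ (1 / 3 : ℝ) := by rw [key, Real.rpow_one]
    _ = |u| ^ (4 / 3 : ℝ) := by rw [← Real.rpow_add' (abs_nonneg u) (by norm_num)]; norm_num

/-- `|sign u |u|^{1/3}|⁴ = |u|^{4/3}`. [folklore] -/
theorem abs_sign_mul_rpow_third_pow_four (u : ℝ) :
    |Real.sign u * |u| ^ (1 / 3 : ℝ)| ^ (4 : ℝ) = |u| ^ (4 / 3 : ℝ) := by
  rcases eq_or_ne u 0 with hu | hu
  · rw [hu]; simp
  · have hs : |Real.sign u| = 1 := by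
      rcases lt_or_gt_of_ne hu with h | h
      · rw [Real.sign_of_neg h]; norm_num
      · rw [Real.sign_of_pos h]; norm_num
    rw [abs_mul, hs, one_mul, abs_of_nonneg (Real.rpow_nonneg (abs_nonneg u) _),
      ← Real.rpow_mul (abs_nonneg u)]
    norm_num

/-- **`T_{-2/5}` is an `L^{4/3}` contraction** (O'Donnell 2014, Thm. 10.44 for `q = 4/3`, from the
`q = 4` case `avg_pow_four_stepOne_neg_le` by duality, Prop. 9.19: with `u = T h`,
`g = sign(u)|u|^{1/3}`, `E|u|^{4/3} = E[u g] = E[h · T g] ≤ ‖h‖_{4/3} ‖T g‖₄ ≤ ‖h‖_{4/3} ‖g‖₄ =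
‖h‖_{4/3} (E|u|^{4/3})^{1/4}`). [cite: ODonnell2014, Theorem 10.44] -/
theorem avg_rpow_stepOne_neg_le (h : Ω → ℝ) :
    avg (fun ω => |stepOne (-2 / 5) h ω| ^ (4 / 3 : ℝ)) ≤ avg fun ω => |h ω| ^ (4 / 3 : ℝ) := by
  set u : Ω → ℝ := stepOne (-2 / 5) h with hu
  set g : Ω → ℝ := fun ω => Real.sign (u ω) * |u ω| ^ (1 / 3 : ℝ) with hg
  set A : ℝ := avg fun ω => |u ω| ^ (4 / 3 : ℝ) with hA
  set B : ℝ := avg fun ω => |h ω| ^ (4 / 3 : ℝ) with hB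
  have hA0 : 0 ≤ A := avg_nonneg fun ω => Real.rpow_nonneg (abs_nonneg _) _
  have hB0 : 0 ≤ B := avg_nonneg fun ω => Real.rpow_nonneg (abs_nonneg _) _
  -- `A = E[u g] = E[h · T g]`
  have h1 : A = avg (fun ω => h ω * stepOne (-2 / 5) g ω) := by
    rw [← avg_stepOne_mul]
    exact avg_congr fun ω => (mul_sign_mul_rpow_third (u ω)).symm
  -- Hölder `(4/3, 4)`
  have hpq : (4 / 3 : ℝ).HolderConjugate 4 := Real.holderConjugate_iff.2 ⟨by norm_num, by norm_num⟩
  have h2 := avg_mul_le_holder hpq h (stepOne (-2 / 5) g)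
  -- `E|T g|⁴ ≤ E g⁴ = A`
  have h3 : avg (fun ω => |stepOne (-2 / 5) g ω| ^ (4 : ℝ)) ≤ A := by
    have e1 : ∀ ω, |stepOne (-2 / 5) g ω| ^ (4 : ℝ) = stepOne (-2 / 5) g ω ^ 4 := by
      intro ω
      rw [show (4 : ℝ) = ((4 : ℕ) : ℝ) by norm_num, Real.rpow_natCast, pow_abs,
        abs_of_nonneg (by positivity)]
    have e2 : ∀ ω, g ω ^ 4 = |u ω| ^ (4 / 3 : ℝ) := by
      intro ω
      rw [← abs_sign_mul_rpow_third_pow_four (u ω), show (4 : ℝ) = ((4 : ℕ) : ℝ) by norm_num,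
        Real.rpow_natCast, pow_abs, abs_of_nonneg (by positivity)]
    calc avg (fun ω => |stepOne (-2 / 5) g ω| ^ (4 : ℝ)) = avg (fun ω => stepOne (-2 / 5) g ω ^ 4) :=
          avg_congr e1
      _ ≤ avg (fun ω => g ω ^ 4) := avg_pow_four_stepOne_neg_le g
      _ = A := avg_congr e2
  -- combine: `A ≤ B^{3/4} A^{1/4}`
  have h4 : A ≤ B ^ (1 / (4 / 3) : ℝ) * A ^ (1 / 4 : ℝ) := by
    calc A = avg (fun ω => h ω * stepOne (-2 / 5) g ω) := h1
      _ ≤ B ^ (1 / (4 / 3) : ℝ) * (avg fun ω => |stepOne (-2 / 5) g ω| ^ (4 : ℝ)) ^ (1 / 4 : ℝ) := h2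
      _ ≤ B ^ (1 / (4 / 3) : ℝ) * A ^ (1 / 4 : ℝ) := by
          apply mul_le_mul_of_nonneg_left _ (Real.rpow_nonneg hB0 _)
          exact Real.rpow_le_rpow (avg_nonneg fun ω => Real.rpow_nonneg (abs_nonneg _) _) h3
            (by norm_num)
  rcases hA0.eq_or_lt with hA00 | hApos
  · rw [← hA00]; exact hB0
  · -- divide by `A^{1/4}` and raise to the power `4/3`
    have hA14 : 0 < A ^ (1 / 4 : ℝ) := Real.rpow_pos_of_pos hApos _
    have h5 : A ^ (3 / 4 : ℝ) ≤ B ^ (3 / 4 : ℝ) := by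
      have e : A ^ (3 / 4 : ℝ) = A / A ^ (1 / 4 : ℝ) := by
        rw [eq_div_iff hA14.ne', ← Real.rpow_add hApos]; norm_num
      rw [e, div_le_iff₀ hA14]
      norm_num at h4
      exact h4
    have := Real.rpow_le_rpow (Real.rpow_nonneg hA0 _) h5 (show (0 : ℝ) ≤ 4 / 3 by norm_num)
    rw [← Real.rpow_mul hA0, ← Real.rpow_mul hB0] at this
    norm_num at this
    exact this

/-- The one-variable contraction for all admissible `ρ ∈ [0,1] ∪ {-2/5}`, `q = 4/3`.
[cite: ODonnell2014, Theorem 10.44] -/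
theorem avg_rpow_stepOne_le {ρ : ℝ} (hρ : (0 ≤ ρ ∧ ρ ≤ 1) ∨ ρ = -2 / 5) (h : Ω → ℝ) :
    avg (fun ω => |stepOne ρ h ω| ^ (4 / 3 : ℝ)) ≤ avg fun ω => |h ω| ^ (4 / 3 : ℝ) := by
  rcases hρ with ⟨h0, h1⟩ | rfl
  · exact avg_rpow_stepOne_le_of_nonneg h0 h1 h (by norm_num)
  · exact avg_rpow_stepOne_neg_le h

/-- The one-variable contraction for all admissible `ρ ∈ [0,1] ∪ {-2/5}`, `q = 4`.
[cite: ODonnell2014, Theorem 10.44] -/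
theorem avg_pow_four_stepOne_le {ρ : ℝ} (hρ : (0 ≤ ρ ∧ ρ ≤ 1) ∨ ρ = -2 / 5) (h : Ω → ℝ) :
    avg (fun ω => stepOne ρ h ω ^ 4) ≤ avg fun ω => h ω ^ 4 := by
  rcases hρ with ⟨h0, h1⟩ | rfl
  · have := avg_rpow_stepOne_le_of_nonneg h0 h1 h (q := 4) (by norm_num)
    have e : ∀ t : ℝ, |t| ^ (4 : ℝ) = t ^ 4 := fun t => by
      rw [show (4 : ℝ) = ((4 : ℕ) : ℝ) by norm_num, Real.rpow_natCast, pow_abs,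
        abs_of_nonneg (by positivity)]
    simp only [e] at this
    exact this
  · exact avg_pow_four_stepOne_neg_le h

end OneVar

/-! ### The operators `T^i_ρ` and `T_r` on the product space -/

variable {ι Ω : Type*} [Fintype ι] [DecidableEq ι] [Fintype Ω] [Nonempty Ω]

/-- `T^i_ρ u = E_i u + ρ (u - E_i u)` (O'Donnell 2014, Def. 10.40, (10.14)).
[cite: ODonnell2014, Def. 10.40] -/
def stepT (i : ι) (ρ : ℝ) (u : (ι → Ω) → ℝ) (x : ι → Ω) : ℝ :=
  proj ({i}ᶜ) u x + ρ * (u x - proj ({i}ᶜ) u x)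

/-- `T_r f = ∑_S r^S f^{=S}` (O'Donnell 2014, (10.15)). [cite: ODonnell2014, Def. 10.40] -/
def noiseT (r : ι → ℝ) (f : (ι → Ω) → ℝ) (x : ι → Ω) : ℝ :=
  ∑ S : Finset ι, (∏ i ∈ S, r i) * pure S f x

/-- The partial operator in which only the coordinates of `A` are activated:
`∑_S (∏_{i ∈ S ∩ A} r_i) f^{=S}` (`= ∏_{i ∈ A} T^i_{r_i} f`). [cite: ODonnell2014, Def. 10.40] -/
def noiseTA (A : Finset ι) (r : ι → ℝ) (f : (ι → Ω) → ℝ) (x : ι → Ω) : ℝ :=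
  ∑ S : Finset ι, (∏ i ∈ S ∩ A, r i) * pure S f x

/-- **`T^i_ρ` acts diagonally** on the decomposition:
`T^i_ρ (∑_S a_S f^{=S}) = ∑_S a_S ρ^{[i ∈ S]} f^{=S}` (O'Donnell 2014, (10.14), third formula).
[cite: ODonnell2014, Def. 10.40] -/
theorem stepT_sum_pure (i : ι) (ρ : ℝ) (a : Finset ι → ℝ) (f : (ι → Ω) → ℝ) :
    stepT i ρ (fun x => ∑ S, a S * pure S f x) =
      fun x => ∑ S, (a S * (if i ∈ S then ρ else 1)) * pure S f x := by
  funext x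
  unfold stepT
  have hE : proj ({i}ᶜ) (fun x => ∑ S, a S * pure S f x) x =
      ∑ S, a S * (if i ∈ S then 0 else pure S f x) := by
    rw [proj_finset_sum]
    simp only
    refine Finset.sum_congr rfl fun S _ => ?_
    rw [proj_mul_left, proj_pure]
    have : S ⊆ {i}ᶜ ↔ i ∉ S := by
      rw [Finset.subset_compl_iff_disjoint_right, Finset.disjoint_singleton_right]
    simp only
    by_cases hi : i ∈ S
    · rw [if_neg (fun h => this.1 h hi), if_pos hi]
    · rw [if_pos (this.2 hi), if_neg hi]
  rw [hE]
  beta_reduce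
  rw [← Finset.sum_sub_distrib, Finset.mul_sum, ← Finset.sum_add_distrib]
  refine Finset.sum_congr rfl fun S _ => ?_
  split_ifs <;> ring

/-- No coordinate activated: `noiseTA ∅ r f = f`. [cite: ODonnell2014, Def. 10.40] -/
theorem noiseTA_empty (r : ι → ℝ) (f : (ι → Ω) → ℝ) : noiseTA ∅ r f = f := by
  funext x
  unfold noiseTA
  simp only [Finset.inter_empty, Finset.prod_empty, one_mul]
  exact sum_pure f x

omit [Nonempty Ω] in
/-- All coordinates activated: `noiseTA univ r f = T_r f`. [cite: ODonnell2014, Def. 10.40] -/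
theorem noiseTA_univ (r : ι → ℝ) (f : (ι → Ω) → ℝ) : noiseTA Finset.univ r f = noiseT r f := by
  funext x
  unfold noiseTA noiseT
  simp only [Finset.inter_univ]

/-- **`T_r = ∏_i T^i_{r_i}`**, one coordinate at a time:
`noiseTA (insert i A) r f = T^i_{r_i} (noiseTA A r f)` for `i ∉ A`. [cite: ODonnell2014, Def. 10.40] -/
theorem noiseTA_insert {i : ι} {A : Finset ι} (hi : i ∉ A) (r : ι → ℝ) (f : (ι → Ω) → ℝ) :
    noiseTA (insert i A) r f = stepT i (r i) (noiseTA A r f) := by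
  have e : noiseTA A r f = fun x => ∑ S, (∏ j ∈ S ∩ A, r j) * pure S f x := rfl
  rw [e, stepT_sum_pure]
  funext x
  unfold noiseTA
  refine Finset.sum_congr rfl fun S _ => ?_
  congr 1
  by_cases hiS : i ∈ S
  · rw [if_pos hiS, Finset.inter_insert_of_mem hiS, Finset.prod_insert (fun h => hi (Finset.mem_inter.1 h).2),
      mul_comm]
  · rw [if_neg hiS, Finset.inter_insert_of_notMem hiS, mul_one]

/-! ### Fibering over one coordinate -/

/-- `E_i u (x) = E_ω u(x with xᵢ := ω)`. [cite: ODonnell2014, Def. 8.27] -/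
theorem proj_compl_singleton_eq_avg_update (i : ι) (u : (ι → Ω) → ℝ) (x : ι → Ω) :
    proj ({i}ᶜ) u x = avg fun ω : Ω => u (Function.update x i ω) := by
  unfold proj
  have e1 : ∀ y : ι → Ω, ({i}ᶜ : Finset ι).piecewise x y = Function.update x i (y i) := by
    intro y
    rw [Finset.piecewise_compl, Finset.piecewise_singleton]
  simp_rw [e1]
  have e2 : (fun y : ι → Ω => u (Function.update x i (y i))) =
      fun y => (fun p : Ω × ({j // j ≠ i} → Ω) => u (Function.update x i p.1))
        (Equiv.funSplitAt i Ω y) := by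
    funext y; simp [Equiv.funSplitAt, Equiv.piSplitAt]
  rw [e2, avg_comp_equiv (Equiv.funSplitAt i Ω) (fun p : Ω × ({j // j ≠ i} → Ω) =>
    u (Function.update x i p.1))]
  exact avg_prod_fst (fun ω : Ω => u (Function.update x i ω))

/-- **Fibering**: `E u = E_x E_ω u(x with xᵢ := ω)`. [folklore] -/
theorem avg_eq_avg_avg_update (i : ι) (u : (ι → Ω) → ℝ) :
    avg u = avg fun x : ι → Ω => avg fun ω : Ω => u (Function.update x i ω) := by
  rw [← avg_proj ({i}ᶜ) u]
  exact avg_congr fun x => proj_compl_singleton_eq_avg_update i u x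

/-- On the fiber through `x`, `T^i_ρ u` is the one-variable `T_ρ` of the fiber function.
[cite: ODonnell2014, Def. 10.40] -/
theorem stepT_update (i : ι) (ρ : ℝ) (u : (ι → Ω) → ℝ) (x : ι → Ω) (ω : Ω) :
    stepT i ρ u (Function.update x i ω) =
      stepOne ρ (fun ω' : Ω => u (Function.update x i ω')) ω := by
  unfold stepT stepOne
  have e : proj ({i}ᶜ) u (Function.update x i ω) = avg fun ω' : Ω => u (Function.update x i ω') := by
    rw [proj_compl_singleton_eq_avg_update]
    exact avg_congr fun ω' => by rw [Function.update_idem]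
  rw [e]

/-- **`T^i_ρ` is an `L⁴` contraction** for `ρ ∈ [0,1] ∪ {-2/5}` (O'Donnell 2014, (10.21)).
[cite: ODonnell2014, Theorem 10.44] -/
theorem avg_pow_four_stepT_le (i : ι) {ρ : ℝ} (hρ : (0 ≤ ρ ∧ ρ ≤ 1) ∨ ρ = -2 / 5)
    (u : (ι → Ω) → ℝ) : avg (fun x => stepT i ρ u x ^ 4) ≤ avg fun x => u x ^ 4 := by
  rw [avg_eq_avg_avg_update i (fun x => stepT i ρ u x ^ 4), avg_eq_avg_avg_update i (fun x => u x ^ 4)]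
  refine avg_mono fun x => ?_
  simp only [stepT_update]
  exact avg_pow_four_stepOne_le hρ _

/-- **`T^i_ρ` is an `L^{4/3}` contraction** for `ρ ∈ [0,1] ∪ {-2/5}` (O'Donnell 2014, (10.21)).
[cite: ODonnell2014, Theorem 10.44] -/
theorem avg_rpow_stepT_le (i : ι) {ρ : ℝ} (hρ : (0 ≤ ρ ∧ ρ ≤ 1) ∨ ρ = -2 / 5)
    (u : (ι → Ω) → ℝ) :
    avg (fun x => |stepT i ρ u x| ^ (4 / 3 : ℝ)) ≤ avg fun x => |u x| ^ (4 / 3 : ℝ) := by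
  rw [avg_eq_avg_avg_update i (fun x => |stepT i ρ u x| ^ (4 / 3 : ℝ)),
    avg_eq_avg_avg_update i (fun x => |u x| ^ (4 / 3 : ℝ))]
  refine avg_mono fun x => ?_
  simp only [stepT_update]
  exact avg_rpow_stepOne_le hρ _

/-- **Theorem 10.44 for `q = 4`** (O'Donnell 2014): if every `r_i ∈ [0,1] ∪ {-2/5}` (e.g.
`r = (2/5)·(±1, …, ±1)`), then `E (T_r f)⁴ ≤ E f⁴`. [cite: ODonnell2014, Theorem 10.44] -/
theorem avg_pow_four_noiseT_le {r : ι → ℝ} (hr : ∀ i, (0 ≤ r i ∧ r i ≤ 1) ∨ r i = -2 / 5)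
    (f : (ι → Ω) → ℝ) : avg (fun x => noiseT r f x ^ 4) ≤ avg fun x => f x ^ 4 := by
  have key : ∀ A : Finset ι, avg (fun x => noiseTA A r f x ^ 4) ≤ avg fun x => f x ^ 4 := by
    intro A
    induction A using Finset.induction_on with
    | empty => rw [noiseTA_empty]
    | insert i A hi ih =>
      rw [noiseTA_insert hi]
      exact (avg_pow_four_stepT_le i (hr i) _).trans ih
  have := key Finset.univ
  rwa [noiseTA_univ] at this

/-- **Theorem 10.44 for `q = 4/3`** (O'Donnell 2014): if every `r_i ∈ [0,1] ∪ {-2/5}`, then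
`E |T_r f|^{4/3} ≤ E |f|^{4/3}`. [cite: ODonnell2014, Theorem 10.44] -/
theorem avg_rpow_noiseT_le {r : ι → ℝ} (hr : ∀ i, (0 ≤ r i ∧ r i ≤ 1) ∨ r i = -2 / 5)
    (f : (ι → Ω) → ℝ) :
    avg (fun x => |noiseT r f x| ^ (4 / 3 : ℝ)) ≤ avg fun x => |f x| ^ (4 / 3 : ℝ) := by
  have key : ∀ A : Finset ι,
      avg (fun x => |noiseTA A r f x| ^ (4 / 3 : ℝ)) ≤ avg fun x => |f x| ^ (4 / 3 : ℝ) := by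
    intro A
    induction A using Finset.induction_on with
    | empty => rw [noiseTA_empty]
    | insert i A hi ih =>
      rw [noiseTA_insert hi]
      exact (avg_rpow_stepT_le i (hr i) _).trans ih
  have := key Finset.univ
  rwa [noiseTA_univ] at this

/-! ### How `T_r`, `L_i` and centering act on the pure components -/

/-- `f ↦ f^{=S}` commutes with `f ↦ f^{⊆T}`. [cite: ODonnell2014, §8.3] -/
theorem pure_proj_comm (S T : Finset ι) (f : (ι → Ω) → ℝ) (x : ι → Ω) :
    pure S (proj T f) x = proj T (pure S f) x := by
  have e : pure S f = fun y => ∑ T' ∈ S.powerset, (-1 : ℝ) ^ (S.card + T'.card) * proj T' f y := rfl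
  rw [e, proj_finset_sum]
  unfold pure
  refine Finset.sum_congr rfl fun T' _ => ?_
  rw [proj_mul_left, proj_proj, proj_proj, Finset.inter_comm]

/-- **`(L_i f)^{=S} = [i ∈ S] f^{=S}`** (O'Donnell 2014, Prop. 8.33). [cite: ODonnell2014, Prop. 8.33] -/
theorem pure_coordL (S : Finset ι) (i : ι) (f : (ι → Ω) → ℝ) (x : ι → Ω) :
    pure S (coordL i f) x = if i ∈ S then pure S f x else 0 := by
  have e : coordL i f = fun y => f y - proj ({i}ᶜ) f y := rfl
  rw [e, pure_sub, pure_proj_comm, proj_pure]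
  have : S ⊆ {i}ᶜ ↔ i ∉ S := by
    rw [Finset.subset_compl_iff_disjoint_right, Finset.disjoint_singleton_right]
  by_cases hi : i ∈ S
  · rw [if_neg (fun h => this.1 h hi), if_pos hi]; simp
  · rw [if_pos (this.2 hi), if_neg hi]; simp

/-- `T_r (L_i f) = ∑_{S ∋ i} r^S f^{=S}`. [cite: ODonnell2014, §10.5] -/
theorem noiseT_coordL (r : ι → ℝ) (i : ι) (f : (ι → Ω) → ℝ) (x : ι → Ω) :
    noiseT r (coordL i f) x = ∑ S, (if i ∈ S then (∏ j ∈ S, r j) else 0) * pure S f x := by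
  unfold noiseT
  refine Finset.sum_congr rfl fun S _ => ?_
  rw [pure_coordL]
  split_ifs <;> simp

/-- `T_r (f - E f) = ∑_{S ≠ ∅} r^S f^{=S}`. [cite: ODonnell2014, §10.5] -/
theorem noiseT_sub_avg (r : ι → ℝ) (f : (ι → Ω) → ℝ) (x : ι → Ω) :
    noiseT r (fun y => f y - avg f) x = ∑ S, (if S = ∅ then 0 else ∏ j ∈ S, r j) * pure S f x := by
  unfold noiseT
  refine Finset.sum_congr rfl fun S _ => ?_
  by_cases hS : S = ∅
  · subst hS
    rw [if_pos rfl, zero_mul, pure_empty, avg_sub, avg_const, sub_self, mul_zero]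
  · rw [if_neg hS, pure_sub_avg (Finset.nonempty_iff_ne_empty.2 hS)]

end ProductSpace

end Literature.Computability.Complexity

end
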